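import Summits.QuantumFields.BalabanUV.Beta.GAN24.ExponentialChartJets
import Summits.QuantumFields.BalabanUV.Beta.GAN24.CouplingCurveTaylor

/-!
# `BalabanUV.Beta.GAN24.ExponentialChartMixedJets` — binder row G-an2-4 ∕ (CONV-C), route R7 «TWO CURRENCIES», PART 252: THE TWO-PARAMETER EXPONENTIAL CHART `U_{s,r} = exp(iη(sA + rB))`
# OF TWO REAL CONNECTIONS — ITS CONNECTION AND ZEROTH-ORDER FIELD, THE SEPARATE PARTIAL JETS AT THE ORIGIN, AND THE MATRIX-LEVEL PARTIAL DERIVATIVES OF THE EXACT ABELIAN COVARIANT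
# LAPLACIAN `Δ^{U_{s,r}} − Δ^1` (NE2's `covPert`).  With `θ = iA∕n`, `φ = iB∕n` (`n = η⁻¹ = L^k`): `U_{s,r} = e^{θs + φr}` (abelian: `= e^{θs}e^{φr}`), `−w_{s,r} = n − n·e^{θs + φr}`,
# `z_{s,r} = −n²Σ_ν(e^{θ_νs + φ_νr} + e^{−θ_νs − φ_νr} − 2)` (UNSHIFTED, as in PART 245: `|U_{s,r}| = 1`); the partial jets PART 251 consumes: `∂_s|₀(−w) = −iA·e^{φr}` (as a function of `r`),
# its `r`-derivative at `0` the MIXED connection jet `−(iA)(iB)∕n`; `∂_s|₀z = −n²Σ_ν(θ_νe^{φ_νr} − θ_νe^{−φ_νr})` (vanishing at `r = 0`), its `r`-derivative at `0` the MIXED zeroth-order jet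
# `−2Σ_ν(iA_ν)(iB_ν) = 2Σ_νA_νB_ν`; restrictions: `r = 0` ∕ `s = 0` ∕ the diagonal `s = r` are the one-parameter exponential charts of `A` ∕ `B` ∕ `A + B` (PART 245), and the swap
# `(A, B, s, r) ↔ (B, A, r, s)`.  PART 253 proves the mixed jets are backgrounds and the jet polarisation identities; PART 254 reads the END (unit b2b-balaban-gan24-p3, gen 66; v1)

NOT IN PRINT; OUR PROOF ([folklore] one-variable calculus BY NAME: Mathlib's `HasDerivAt.cexp`, `HasDerivAt.ofReal_comp`, `HasDerivAt.fun_sum ∕ fun_add ∕ const_mul ∕ const_sub`; PART 245's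
`hasDerivAt_const_mul_cexp`, `zT_expChart` (read at the real connection `sA + rB` and time `1`); PART 241's `hasDerivAt_Pmodel_curve`, `hasDerivAt_conjTranspose_Pmodel_curve`,
`hasDerivAt_diagonal_curve`; NE2's `covPert_eq`, `covLap_one`; [Balaban1985BackgroundPropagators] (3.3) p. 390, (3.35) p. 396 LOCATE the shapes (`U = e^{iηA}`); nothing printed is a
hypothesis).
HONEST FRAMING (cell contract, verbatim): «discharging `BetaPertH` makes Bałaban's UV stability UNCONDITIONAL — a real constructive-QFT result; it is NOT the
continuum limit and NOT the Clay problem.»  HONEST DEPENDENCY (verbatim): «continuum YM on T⁴ ⇐ BetaPertH ∧ nine spine estimates (0/9 proved); BetaPertH ⇐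
(D1) ∧ (D4) ∧ CAP+tail; G-an2-4 gates asym, D1 and NE2/3/4.»

WHAT THIS FILE PROVES (0 sorry, 0 `def`; `U^{A,B}_{s,r} k ν x = exp((I·A k ν x∕n_k)·s + (I·B k ν x∕n_k)·r)`, `A, B` REAL):
* §1 (scalar) `hasDerivAt_const_mul_cexp_add_fst ∕ _snd`, `hasDerivAt_cexp_add_fst` (`∂_s[c·e^{θs + φr}] = cθ·e^{θs + φr}` etc.).
* §2 (the chart) `expChart₂_snd_zero`, `expChart₂_fst_zero`, `expChart₂_diag`, `expChart₂_swap`, `expChart₂_zero_zero`, **`connV_expChart₂`**, **`zT_expChart₂`**, `covPert_expChart₂_zero_zero`.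
* §3 (scalar partial jets at the origin) **`hasDerivAt_connV_expChart₂_fst`** (`∂_s|₀(−w_{s,r}) = −iA·e^{φr}`), **`hasDerivAt_mixedJetV`** (`∂_r|₀[−iA·e^{φr}] = −(iA)(iB)∕n`),
  **`hasDerivAt_zT_expChart₂_fst`**, **`hasDerivAt_mixedJetZ`** (`∂_r|₀∂_s|₀z = −2Σ_ν(iA_ν)(iB_ν)`), `mixedCurveV_zero`, `mixedCurveZ_zero` (at `r = 0` the first partial jets are `−iA` and `0`).
* §4 (matrix level, every volume, every level `k`) **`hasDerivAt_covPert_expChart₂_fst`** (`∂_s|₀(Δ^{U_{s,r}} − Δ^1) = P(V₁₀(r)) + P(V₁₀(r))ᴴ + diag Z₁₀(r)` for every `r`),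
  **`hasDerivAt_mixedLetter`** (`∂_r|₀` of that letter `= P(V₁₁) + P(V₁₁)ᴴ + diag Z₁₁`, the MIXED coupling letter), **`hasDerivAt_covPert_expChart₂_snd_zero`** (`∂_r|₀(Δ^{U_{0,r}} − Δ^1)` = the
  first letter of `B`), `mixedLetter_fst_zero` (`P₁₀(0)` = the first letter of `A`) — exactly the hypotheses `h10, ha, h01, h11` of PART 251's `deriv_deriv_inv_readout_two_param`.
WHAT IT DOES NOT DO: the background properties of the mixed jets and the jet polarisation identities (PART 253); the END (PART 254).  SUPPLIER work; NEVER «G-an2-4 closed»; NOT (CONV-C),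
NOT D1, NOT `BetaPertH`, NOT continuum, NOT Clay.  Records: `HOME/b2b-balaban-gan24-p3/gen66/README.md`.
-/

noncomputable section

open scoped BigOperators ComplexConjugate Matrix Matrix.Norms.L2Operator
open Filter Topology

namespace Summit.QuantumFields.BalabanUV.Beta.GAN24.ExponentialChartMixedJets

open Literature.MathematicalPhysics.QuantumFieldTheory.Balaban1983to89
open Literature.MathematicalPhysics.QuantumFieldTheory.Balaban1983to89.B5Prop11Plancherel (Tor fine)
open Literature.MathematicalPhysics.QuantumFieldTheory.Balaban1983to89.B5G183RateUnitTower (lev)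
open Summit.QuantumFields.BalabanUV.T4Continuum
open Summit.QuantumFields.BalabanUV.T4Continuum.BalabanAveragedTowerUnit (idx)
open Summit.QuantumFields.BalabanUV.T4Continuum.FirstOrderBackgroundModel (Pmodel)
open Summit.QuantumFields.BalabanUV.T4Continuum.AbelianCovariantLaplacian (covPert connV zT covPert_eq conn negConn covLap_one)
open Summit.QuantumFields.BalabanUV.Beta.GAN24.ExponentialChartJets (hasDerivAt_const_mul_cexp zT_expChart)
open Summit.QuantumFields.BalabanUV.Beta.GAN24.CouplingCurveTaylor (hasDerivAt_Pmodel_curve hasDerivAt_conjTranspose_Pmodel_curve hasDerivAt_diagonal_curve)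

/-! ## §1 Scalar calculus of `(s, r) ↦ c·e^{θs + φr}` over two real parameters -/

section Scalar

/-- `∂_s[c·e^{θs + φr}] = cθ·e^{θs + φr}` (first parameter; real parameters, complex values). [folklore] -/
theorem hasDerivAt_const_mul_cexp_add_fst (c θ φ : ℂ) (r s : ℝ) :
    HasDerivAt (fun v : ℝ => c * Complex.exp (θ * (v : ℂ) + φ * (r : ℂ))) (c * θ * Complex.exp (θ * (s : ℂ) + φ * (r : ℂ))) s := by
  have hθ : HasDerivAt (fun v : ℝ => θ * (v : ℂ) + φ * (r : ℂ)) θ s := by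
    simpa using (((hasDerivAt_id s).ofReal_comp).const_mul θ).add_const (φ * (r : ℂ))
  have h := (hθ.cexp).const_mul c
  refine h.congr_deriv ?_
  ring

/-- `∂_s[e^{θs + φr}] = θ·e^{θs + φr}`. [folklore] -/
theorem hasDerivAt_cexp_add_fst (θ φ : ℂ) (r s : ℝ) :
    HasDerivAt (fun v : ℝ => Complex.exp (θ * (v : ℂ) + φ * (r : ℂ))) (θ * Complex.exp (θ * (s : ℂ) + φ * (r : ℂ))) s := by
  have h := hasDerivAt_const_mul_cexp_add_fst 1 θ φ r s
  simp only [one_mul] at h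
  exact h

/-- `∂_r[c·e^{θs + φr}] = cφ·e^{θs + φr}` (second parameter). [folklore] -/
theorem hasDerivAt_const_mul_cexp_add_snd (c θ φ : ℂ) (s r : ℝ) :
    HasDerivAt (fun v : ℝ => c * Complex.exp (θ * (s : ℂ) + φ * (v : ℂ))) (c * φ * Complex.exp (θ * (s : ℂ) + φ * (r : ℂ))) r := by
  have hφ : HasDerivAt (fun v : ℝ => θ * (s : ℂ) + φ * (v : ℂ)) φ r := by
    simpa using (((hasDerivAt_id r).ofReal_comp).const_mul φ).const_add (θ * (s : ℂ))
  have h := (hφ.cexp).const_mul c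
  refine h.congr_deriv ?_
  ring

end Scalar

/-! ## §2 The two-parameter exponential chart: restrictions, connection, zeroth-order field -/

section Chart

variable {d : ℕ} (L : ℕ) [NeZero L] (M : Fin d → ℕ) [hM : ∀ μ, NeZero (M μ)]

omit [NeZero L] hM in
/-- restriction `r = 0`: the exponential chart of `A` (PART 245). [folklore] -/
theorem expChart₂_snd_zero (A B : (k : ℕ) → Fin d → (idx L M k → ℝ)) (s : ℝ) :
    (fun k ν (x : idx L M k) => Complex.exp ((Complex.I * (A k ν x : ℂ) / ((lev L k : ℕ) : ℂ)) * (s : ℂ) + (Complex.I * (B k ν x : ℂ) / ((lev L k : ℕ) : ℂ)) * ((0 : ℝ) : ℂ)))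
      = fun k ν x => Complex.exp ((Complex.I * (A k ν x : ℂ) / ((lev L k : ℕ) : ℂ)) * (s : ℂ)) := by
  funext k ν x
  rw [Complex.ofReal_zero, mul_zero, add_zero]

omit [NeZero L] hM in
/-- restriction `s = 0`: the exponential chart of `B`. [folklore] -/
theorem expChart₂_fst_zero (A B : (k : ℕ) → Fin d → (idx L M k → ℝ)) (r : ℝ) :
    (fun k ν (x : idx L M k) => Complex.exp ((Complex.I * (A k ν x : ℂ) / ((lev L k : ℕ) : ℂ)) * ((0 : ℝ) : ℂ) + (Complex.I * (B k ν x : ℂ) / ((lev L k : ℕ) : ℂ)) * (r : ℂ)))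
      = fun k ν x => Complex.exp ((Complex.I * (B k ν x : ℂ) / ((lev L k : ℕ) : ℂ)) * (r : ℂ)) := by
  funext k ν x
  rw [Complex.ofReal_zero, mul_zero, zero_add]

omit [NeZero L] hM in
/-- the diagonal `s = r = v`: the exponential chart of the REAL connection `A + B`. [folklore] -/
theorem expChart₂_diag (A B : (k : ℕ) → Fin d → (idx L M k → ℝ)) (v : ℝ) :
    (fun k ν (x : idx L M k) => Complex.exp ((Complex.I * (A k ν x : ℂ) / ((lev L k : ℕ) : ℂ)) * (v : ℂ) + (Complex.I * (B k ν x : ℂ) / ((lev L k : ℕ) : ℂ)) * (v : ℂ)))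
      = fun k ν x => Complex.exp ((Complex.I * ((A k ν x + B k ν x : ℝ) : ℂ) / ((lev L k : ℕ) : ℂ)) * (v : ℂ)) := by
  funext k ν x
  congr 1
  push_cast
  ring

omit [NeZero L] hM in
/-- the swap `(A, B, s, r) ↔ (B, A, r, s)`. [folklore] -/
theorem expChart₂_swap (A B : (k : ℕ) → Fin d → (idx L M k → ℝ)) (s r : ℝ) :
    (fun k ν (x : idx L M k) => Complex.exp ((Complex.I * (A k ν x : ℂ) / ((lev L k : ℕ) : ℂ)) * (s : ℂ) + (Complex.I * (B k ν x : ℂ) / ((lev L k : ℕ) : ℂ)) * (r : ℂ)))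
      = fun k ν x => Complex.exp ((Complex.I * (B k ν x : ℂ) / ((lev L k : ℕ) : ℂ)) * (r : ℂ) + (Complex.I * (A k ν x : ℂ) / ((lev L k : ℕ) : ℂ)) * (s : ℂ)) := by
  funext k ν x
  rw [add_comm]

omit [NeZero L] hM in
/-- at the origin the chart is the trivial background `U = 1`. [folklore] -/
theorem expChart₂_zero_zero (A B : (k : ℕ) → Fin d → (idx L M k → ℝ)) :
    (fun k ν (x : idx L M k) => Complex.exp ((Complex.I * (A k ν x : ℂ) / ((lev L k : ℕ) : ℂ)) * ((0 : ℝ) : ℂ) + (Complex.I * (B k ν x : ℂ) / ((lev L k : ℕ) : ℂ)) * ((0 : ℝ) : ℂ)))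
      = fun _ _ _ => (1 : ℂ) := by
  funext k ν x
  rw [Complex.ofReal_zero, mul_zero, mul_zero, add_zero, Complex.exp_zero]

omit [NeZero L] hM in
/-- **`connV_expChart₂`**: `−w_{s,r} = n − n·e^{θs + φr}` at every level. [folklore] -/
theorem connV_expChart₂ (A B : (k : ℕ) → Fin d → (idx L M k → ℝ)) (s r : ℝ) :
    connV L M (fun k ν x => Complex.exp ((Complex.I * (A k ν x : ℂ) / ((lev L k : ℕ) : ℂ)) * (s : ℂ) + (Complex.I * (B k ν x : ℂ) / ((lev L k : ℕ) : ℂ)) * (r : ℂ)))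
      = fun k ν x => ((lev L k : ℕ) : ℂ) - ((lev L k : ℕ) : ℂ) * Complex.exp ((Complex.I * (A k ν x : ℂ) / ((lev L k : ℕ) : ℂ)) * (s : ℂ) + (Complex.I * (B k ν x : ℂ) / ((lev L k : ℕ) : ℂ)) * (r : ℂ)) := by
  funext k ν x
  simp only [connV, negConn, conn]
  ring

omit [NeZero L] hM in
/-- **`zT_expChart₂`**: the zeroth-order field of the two-parameter chart is UNSHIFTED: `z_{s,r}(x) = −n²Σ_ν(e^{θ_νs + φ_νr} + e^{−θ_νs − φ_νr} − 2)` — PART 245's `zT_expChart` read at the real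
connection `sA + rB` and time `1`. [folklore] -/
theorem zT_expChart₂ (A B : (k : ℕ) → Fin d → (idx L M k → ℝ)) (s r : ℝ) :
    zT L M (fun k ν x => Complex.exp ((Complex.I * (A k ν x : ℂ) / ((lev L k : ℕ) : ℂ)) * (s : ℂ) + (Complex.I * (B k ν x : ℂ) / ((lev L k : ℕ) : ℂ)) * (r : ℂ)))
      = fun k x => -((lev L k : ℕ) : ℂ) ^ 2 * ∑ ν, (Complex.exp ((Complex.I * (A k ν x : ℂ) / ((lev L k : ℕ) : ℂ)) * (s : ℂ) + (Complex.I * (B k ν x : ℂ) / ((lev L k : ℕ) : ℂ)) * (r : ℂ))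
          + Complex.exp (-(Complex.I * (A k ν x : ℂ) / ((lev L k : ℕ) : ℂ)) * (s : ℂ) + -(Complex.I * (B k ν x : ℂ) / ((lev L k : ℕ) : ℂ)) * (r : ℂ)) - 2) := by
  have e : (fun k ν (x : idx L M k) => Complex.exp ((Complex.I * (A k ν x : ℂ) / ((lev L k : ℕ) : ℂ)) * (s : ℂ) + (Complex.I * (B k ν x : ℂ) / ((lev L k : ℕ) : ℂ)) * (r : ℂ)))
      = fun k ν x => Complex.exp ((Complex.I * ((s * A k ν x + r * B k ν x : ℝ) : ℂ) / ((lev L k : ℕ) : ℂ)) * ((1 : ℝ) : ℂ)) := by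
    funext k ν x
    congr 1
    push_cast
    ring
  rw [e]
  refine (zT_expChart L M (fun k ν x => s * A k ν x + r * B k ν x) 1).trans ?_
  funext k x
  congr 1
  refine Finset.sum_congr rfl fun ν _ => ?_
  have h1 : Complex.exp ((Complex.I * ((s * A k ν x + r * B k ν x : ℝ) : ℂ) / ((lev L k : ℕ) : ℂ)) * ((1 : ℝ) : ℂ))
      = Complex.exp ((Complex.I * (A k ν x : ℂ) / ((lev L k : ℕ) : ℂ)) * (s : ℂ) + (Complex.I * (B k ν x : ℂ) / ((lev L k : ℕ) : ℂ)) * (r : ℂ)) := by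
    congr 1
    push_cast
    ring
  have h2 : Complex.exp (-(Complex.I * ((s * A k ν x + r * B k ν x : ℝ) : ℂ) / ((lev L k : ℕ) : ℂ)) * ((1 : ℝ) : ℂ))
      = Complex.exp (-(Complex.I * (A k ν x : ℂ) / ((lev L k : ℕ) : ℂ)) * (s : ℂ) + -(Complex.I * (B k ν x : ℂ) / ((lev L k : ℕ) : ℂ)) * (r : ℂ)) := by
    congr 1
    push_cast
    ring
  rw [h1, h2]

/-- at the origin the perturbation vanishes: `Δ^{U_{0,0}} − Δ^1 = Δ^1 − Δ^1 = 0` (NE2's `covLap_one`). [folklore] -/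
theorem covPert_expChart₂_zero_zero (A B : (k : ℕ) → Fin d → (idx L M k → ℝ)) (k : ℕ) :
    covPert L M (fun k ν (x : idx L M k) => Complex.exp ((Complex.I * (A k ν x : ℂ) / ((lev L k : ℕ) : ℂ)) * ((0 : ℝ) : ℂ) + (Complex.I * (B k ν x : ℂ) / ((lev L k : ℕ) : ℂ)) * ((0 : ℝ) : ℂ))) k
      = 0 := by
  rw [expChart₂_zero_zero]
  have h1 : ((fun (_ : ℕ) (_ : Fin d) (_ : idx L M k) => (1 : ℂ)) k) = (1 : Fin d → (idx L M k → ℂ)) := rfl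
  show AbelianCovariantLaplacian.covLap (fine (lev L k) M) ((lev L k : ℕ) : ℂ) ((fun (_ : ℕ) (_ : Fin d) (_ : idx L M k) => (1 : ℂ)) k)
      - AbelianCovariantLaplacian.lap (fine (lev L k) M) ((lev L k : ℕ) : ℂ) = 0
  rw [h1, covLap_one, sub_self]

end Chart

/-! ## §3 The separate partial jets at the origin (scalar) -/

section Jets

variable {d : ℕ} (L : ℕ) [NeZero L] (M : Fin d → ℕ) [hM : ∀ μ, NeZero (M μ)]

omit hM in
/-- **`hasDerivAt_connV_expChart₂_fst`**: for every `r`, `∂_s|₀(−w_{s,r})^{(k)}_ν(x) = −iA^{(k)}_ν(x)·e^{φr}`, `φ = iB^{(k)}_ν(x)∕n_k`. [folklore] -/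
theorem hasDerivAt_connV_expChart₂_fst (A B : (k : ℕ) → Fin d → (idx L M k → ℝ)) (r : ℝ) (k : ℕ) (ν : Fin d) (x : idx L M k) :
    HasDerivAt (fun s : ℝ => connV L M (fun k' ν' (x' : idx L M k') => Complex.exp ((Complex.I * (A k' ν' x' : ℂ) / ((lev L k' : ℕ) : ℂ)) * (s : ℂ)
        + (Complex.I * (B k' ν' x' : ℂ) / ((lev L k' : ℕ) : ℂ)) * (r : ℂ))) k ν x)
      (-(Complex.I * (A k ν x : ℂ)) * Complex.exp ((Complex.I * (B k ν x : ℂ) / ((lev L k : ℕ) : ℂ)) * (r : ℂ))) 0 := by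
  simp only [connV_expChart₂]
  have h := (hasDerivAt_const_mul_cexp_add_fst ((lev L k : ℕ) : ℂ) (Complex.I * (A k ν x : ℂ) / ((lev L k : ℕ) : ℂ)) (Complex.I * (B k ν x : ℂ) / ((lev L k : ℕ) : ℂ)) r 0).const_sub
    (((lev L k : ℕ) : ℂ))
  refine h.congr_deriv ?_
  have hn : ((lev L k : ℕ) : ℂ) ≠ 0 := by exact_mod_cast NeZero.ne (lev L k)
  rw [Complex.ofReal_zero, mul_zero, zero_add]
  field_simp

omit [NeZero L] hM in
/-- **`hasDerivAt_mixedJetV`** — THE MIXED CONNECTION JET: `∂_r|₀[−iA·e^{φr}] = −(iA)(iB)∕n`. [folklore] -/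
theorem hasDerivAt_mixedJetV (A B : (k : ℕ) → Fin d → (idx L M k → ℝ)) (k : ℕ) (ν : Fin d) (x : idx L M k) :
    HasDerivAt (fun r : ℝ => -(Complex.I * (A k ν x : ℂ)) * Complex.exp ((Complex.I * (B k ν x : ℂ) / ((lev L k : ℕ) : ℂ)) * (r : ℂ)))
      (-(Complex.I * (A k ν x : ℂ)) * (Complex.I * (B k ν x : ℂ) / ((lev L k : ℕ) : ℂ))) 0 := by
  have h := hasDerivAt_const_mul_cexp (-(Complex.I * (A k ν x : ℂ))) (Complex.I * (B k ν x : ℂ) / ((lev L k : ℕ) : ℂ)) 0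
  refine h.congr_deriv ?_
  rw [Complex.ofReal_zero, mul_zero, Complex.exp_zero, mul_one]

omit [NeZero L] hM in
/-- **`hasDerivAt_zT_expChart₂_fst`**: for every `r`, `∂_s|₀z^{(k)}_{s,r}(x) = −n_k²Σ_ν(θ_νe^{φ_νr} + (−θ_ν)e^{−φ_νr})`. [folklore] -/
theorem hasDerivAt_zT_expChart₂_fst (A B : (k : ℕ) → Fin d → (idx L M k → ℝ)) (r : ℝ) (k : ℕ) (x : idx L M k) :
    HasDerivAt (fun s : ℝ => zT L M (fun k' ν' (x' : idx L M k') => Complex.exp ((Complex.I * (A k' ν' x' : ℂ) / ((lev L k' : ℕ) : ℂ)) * (s : ℂ)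
        + (Complex.I * (B k' ν' x' : ℂ) / ((lev L k' : ℕ) : ℂ)) * (r : ℂ))) k x)
      (-((lev L k : ℕ) : ℂ) ^ 2 * ∑ ν, ((Complex.I * (A k ν x : ℂ) / ((lev L k : ℕ) : ℂ)) * Complex.exp ((Complex.I * (B k ν x : ℂ) / ((lev L k : ℕ) : ℂ)) * (r : ℂ))
          + -(Complex.I * (A k ν x : ℂ) / ((lev L k : ℕ) : ℂ)) * Complex.exp (-(Complex.I * (B k ν x : ℂ) / ((lev L k : ℕ) : ℂ)) * (r : ℂ)))) 0 := by
  simp only [zT_expChart₂]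
  have h : HasDerivAt (fun s : ℝ => -((lev L k : ℕ) : ℂ) ^ 2 * ∑ ν, (Complex.exp ((Complex.I * (A k ν x : ℂ) / ((lev L k : ℕ) : ℂ)) * (s : ℂ) + (Complex.I * (B k ν x : ℂ) / ((lev L k : ℕ) : ℂ)) * (r : ℂ))
          + Complex.exp (-(Complex.I * (A k ν x : ℂ) / ((lev L k : ℕ) : ℂ)) * (s : ℂ) + -(Complex.I * (B k ν x : ℂ) / ((lev L k : ℕ) : ℂ)) * (r : ℂ)) - 2))
      (-((lev L k : ℕ) : ℂ) ^ 2 * ∑ ν, ((Complex.I * (A k ν x : ℂ) / ((lev L k : ℕ) : ℂ)) * Complex.exp ((Complex.I * (A k ν x : ℂ) / ((lev L k : ℕ) : ℂ)) * ((0 : ℝ) : ℂ) + (Complex.I * (B k ν x : ℂ) / ((lev L k : ℕ) : ℂ)) * (r : ℂ))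
          + -(Complex.I * (A k ν x : ℂ) / ((lev L k : ℕ) : ℂ)) * Complex.exp (-(Complex.I * (A k ν x : ℂ) / ((lev L k : ℕ) : ℂ)) * ((0 : ℝ) : ℂ) + -(Complex.I * (B k ν x : ℂ) / ((lev L k : ℕ) : ℂ)) * (r : ℂ)))) 0 :=
    (HasDerivAt.fun_sum fun ν _ => ((hasDerivAt_cexp_add_fst _ _ r 0).fun_add (hasDerivAt_cexp_add_fst _ _ r 0)).sub_const (2 : ℂ)).const_mul _
  refine h.congr_deriv ?_
  simp only [Complex.ofReal_zero, mul_zero, zero_add]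

omit hM in
/-- **`hasDerivAt_mixedJetZ`** — THE MIXED ZEROTH-ORDER JET: `∂_r|₀[−n²Σ_ν(θ_νe^{φ_νr} + (−θ_ν)e^{−φ_νr})] = −n²Σ_ν 2θ_νφ_ν = −2Σ_ν(iA_ν)(iB_ν) = 2Σ_νA_νB_ν`. [folklore] -/
theorem hasDerivAt_mixedJetZ (A B : (k : ℕ) → Fin d → (idx L M k → ℝ)) (k : ℕ) (x : idx L M k) :
    HasDerivAt (fun r : ℝ => -((lev L k : ℕ) : ℂ) ^ 2 * ∑ ν, ((Complex.I * (A k ν x : ℂ) / ((lev L k : ℕ) : ℂ)) * Complex.exp ((Complex.I * (B k ν x : ℂ) / ((lev L k : ℕ) : ℂ)) * (r : ℂ))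
          + -(Complex.I * (A k ν x : ℂ) / ((lev L k : ℕ) : ℂ)) * Complex.exp (-(Complex.I * (B k ν x : ℂ) / ((lev L k : ℕ) : ℂ)) * (r : ℂ))))
      (-2 * ∑ ν, (Complex.I * (A k ν x : ℂ)) * (Complex.I * (B k ν x : ℂ))) 0 := by
  have h : HasDerivAt (fun r : ℝ => -((lev L k : ℕ) : ℂ) ^ 2 * ∑ ν, ((Complex.I * (A k ν x : ℂ) / ((lev L k : ℕ) : ℂ)) * Complex.exp ((Complex.I * (B k ν x : ℂ) / ((lev L k : ℕ) : ℂ)) * (r : ℂ))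
          + -(Complex.I * (A k ν x : ℂ) / ((lev L k : ℕ) : ℂ)) * Complex.exp (-(Complex.I * (B k ν x : ℂ) / ((lev L k : ℕ) : ℂ)) * (r : ℂ))))
      (-((lev L k : ℕ) : ℂ) ^ 2 * ∑ ν, ((Complex.I * (A k ν x : ℂ) / ((lev L k : ℕ) : ℂ)) * (Complex.I * (B k ν x : ℂ) / ((lev L k : ℕ) : ℂ)) * Complex.exp ((Complex.I * (B k ν x : ℂ) / ((lev L k : ℕ) : ℂ)) * ((0 : ℝ) : ℂ))
          + -(Complex.I * (A k ν x : ℂ) / ((lev L k : ℕ) : ℂ)) * (-(Complex.I * (B k ν x : ℂ) / ((lev L k : ℕ) : ℂ))) * Complex.exp (-(Complex.I * (B k ν x : ℂ) / ((lev L k : ℕ) : ℂ)) * ((0 : ℝ) : ℂ)))) 0 :=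
    (HasDerivAt.fun_sum fun ν _ => (hasDerivAt_const_mul_cexp _ _ 0).fun_add (hasDerivAt_const_mul_cexp _ _ 0)).const_mul _
  refine h.congr_deriv ?_
  have hn : ((lev L k : ℕ) : ℂ) ≠ 0 := by exact_mod_cast NeZero.ne (lev L k)
  simp only [Complex.ofReal_zero, mul_zero, Complex.exp_zero, mul_one]
  rw [Finset.mul_sum, Finset.mul_sum]
  refine Finset.sum_congr rfl fun ν _ => ?_
  field_simp
  ring

omit [NeZero L] hM in
/-- at `r = 0` the first connection partial jet is `−iA` (the first jet of the exponential chart of `A`, PART 245). [folklore] -/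
theorem mixedCurveV_zero (A B : (k : ℕ) → Fin d → (idx L M k → ℝ)) :
    (fun k ν (x : idx L M k) => -(Complex.I * (A k ν x : ℂ)) * Complex.exp ((Complex.I * (B k ν x : ℂ) / ((lev L k : ℕ) : ℂ)) * ((0 : ℝ) : ℂ)))
      = fun k ν x => -(Complex.I * (A k ν x : ℂ)) := by
  funext k ν x
  rw [Complex.ofReal_zero, mul_zero, Complex.exp_zero, mul_one]

omit [NeZero L] hM in
/-- at `r = 0` the first zeroth-order partial jet vanishes (`θ − θ = 0`). [folklore] -/
theorem mixedCurveZ_zero (A B : (k : ℕ) → Fin d → (idx L M k → ℝ)) :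
    (fun k (x : idx L M k) => -((lev L k : ℕ) : ℂ) ^ 2 * ∑ ν, ((Complex.I * (A k ν x : ℂ) / ((lev L k : ℕ) : ℂ)) * Complex.exp ((Complex.I * (B k ν x : ℂ) / ((lev L k : ℕ) : ℂ)) * ((0 : ℝ) : ℂ))
          + -(Complex.I * (A k ν x : ℂ) / ((lev L k : ℕ) : ℂ)) * Complex.exp (-(Complex.I * (B k ν x : ℂ) / ((lev L k : ℕ) : ℂ)) * ((0 : ℝ) : ℂ))))
      = fun _ _ => (0 : ℂ) := by
  funext k x
  simp only [Complex.ofReal_zero, mul_zero, Complex.exp_zero, mul_one, add_neg_cancel, Finset.sum_const_zero]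

end Jets

/-! ## §4 Matrix level: the separate partial derivatives of `Δ^{U_{s,r}} − Δ^1` at the origin -/

section Letters

variable {d : ℕ} (L : ℕ) [NeZero L] (M : Fin d → ℕ) [hM : ∀ μ, NeZero (M μ)]

/-- **`hasDerivAt_covPert_expChart₂_fst` — `∂_s|₀(Δ^{U_{s,r}} − Δ^1)^{(k)} = P(V₁₀(r)) + P(V₁₀(r))ᴴ + diag Z₁₀(r)` FOR EVERY `r`** (NE2's `covPert_eq` + PART 241's entrywise lift + §3), with
`V₁₀(r) = −iA·e^{φr}`, `Z₁₀(r) = −n²Σ_ν(θ_νe^{φ_νr} + (−θ_ν)e^{−φ_νr})`: the hypothesis `h10` of PART 251. [folklore] -/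
theorem hasDerivAt_covPert_expChart₂_fst (A B : (k : ℕ) → Fin d → (idx L M k → ℝ)) (r : ℝ) (k : ℕ) :
    HasDerivAt (fun s : ℝ => covPert L M (fun k' ν' (x' : idx L M k') => Complex.exp ((Complex.I * (A k' ν' x' : ℂ) / ((lev L k' : ℕ) : ℂ)) * (s : ℂ)
        + (Complex.I * (B k' ν' x' : ℂ) / ((lev L k' : ℕ) : ℂ)) * (r : ℂ))) k)
      (Pmodel L M (fun k' ν' (x' : idx L M k') => -(Complex.I * (A k' ν' x' : ℂ)) * Complex.exp ((Complex.I * (B k' ν' x' : ℂ) / ((lev L k' : ℕ) : ℂ)) * (r : ℂ))) k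
        + (Pmodel L M (fun k' ν' (x' : idx L M k') => -(Complex.I * (A k' ν' x' : ℂ)) * Complex.exp ((Complex.I * (B k' ν' x' : ℂ) / ((lev L k' : ℕ) : ℂ)) * (r : ℂ))) k)ᴴ
        + Matrix.diagonal (fun x' : idx L M k => -((lev L k : ℕ) : ℂ) ^ 2 * ∑ ν, ((Complex.I * (A k ν x' : ℂ) / ((lev L k : ℕ) : ℂ)) * Complex.exp ((Complex.I * (B k ν x' : ℂ) / ((lev L k : ℕ) : ℂ)) * (r : ℂ))
          + -(Complex.I * (A k ν x' : ℂ) / ((lev L k : ℕ) : ℂ)) * Complex.exp (-(Complex.I * (B k ν x' : ℂ) / ((lev L k : ℕ) : ℂ)) * (r : ℂ))))) 0 := by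
  have e : (fun s : ℝ => covPert L M (fun k' ν' (x' : idx L M k') => Complex.exp ((Complex.I * (A k' ν' x' : ℂ) / ((lev L k' : ℕ) : ℂ)) * (s : ℂ)
        + (Complex.I * (B k' ν' x' : ℂ) / ((lev L k' : ℕ) : ℂ)) * (r : ℂ))) k)
      = fun s : ℝ => Pmodel L M (connV L M (fun k' ν' (x' : idx L M k') => Complex.exp ((Complex.I * (A k' ν' x' : ℂ) / ((lev L k' : ℕ) : ℂ)) * (s : ℂ)
          + (Complex.I * (B k' ν' x' : ℂ) / ((lev L k' : ℕ) : ℂ)) * (r : ℂ)))) k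
        + (Pmodel L M (connV L M (fun k' ν' (x' : idx L M k') => Complex.exp ((Complex.I * (A k' ν' x' : ℂ) / ((lev L k' : ℕ) : ℂ)) * (s : ℂ)
          + (Complex.I * (B k' ν' x' : ℂ) / ((lev L k' : ℕ) : ℂ)) * (r : ℂ)))) k)ᴴ
        + Matrix.diagonal (zT L M (fun k' ν' (x' : idx L M k') => Complex.exp ((Complex.I * (A k' ν' x' : ℂ) / ((lev L k' : ℕ) : ℂ)) * (s : ℂ)
          + (Complex.I * (B k' ν' x' : ℂ) / ((lev L k' : ℕ) : ℂ)) * (r : ℂ))) k) :=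
    funext fun s => covPert_eq L M _ k
  rw [e]
  exact ((hasDerivAt_Pmodel_curve L M k (fun μ y => hasDerivAt_connV_expChart₂_fst L M A B r k μ y)).add
    (hasDerivAt_conjTranspose_Pmodel_curve L M k (fun μ y => hasDerivAt_connV_expChart₂_fst L M A B r k μ y))).add
    (hasDerivAt_diagonal_curve L M k
      (Z := fun (s : ℝ) (k' : ℕ) => zT L M (fun k'' ν' (x' : idx L M k'') => Complex.exp ((Complex.I * (A k'' ν' x' : ℂ) / ((lev L k'' : ℕ) : ℂ)) * (s : ℂ)
        + (Complex.I * (B k'' ν' x' : ℂ) / ((lev L k'' : ℕ) : ℂ)) * (r : ℂ))) k')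
      (Z' := fun (k' : ℕ) (x' : idx L M k') => -((lev L k' : ℕ) : ℂ) ^ 2 * ∑ ν, ((Complex.I * (A k' ν x' : ℂ) / ((lev L k' : ℕ) : ℂ)) * Complex.exp ((Complex.I * (B k' ν x' : ℂ) / ((lev L k' : ℕ) : ℂ)) * (r : ℂ))
          + -(Complex.I * (A k' ν x' : ℂ) / ((lev L k' : ℕ) : ℂ)) * Complex.exp (-(Complex.I * (B k' ν x' : ℂ) / ((lev L k' : ℕ) : ℂ)) * (r : ℂ))))
      (fun y => hasDerivAt_zT_expChart₂_fst L M A B r k y))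

/-- **`hasDerivAt_mixedLetter` — THE MIXED COUPLING LETTER**: `∂_r|₀[P(V₁₀(r)) + P(V₁₀(r))ᴴ + diag Z₁₀(r)] = P(V₁₁) + P(V₁₁)ᴴ + diag Z₁₁` with `V₁₁ = −(iA)(iB)∕n`, `Z₁₁ = −2Σ_ν(iA_ν)(iB_ν)`:
the hypothesis `h11` of PART 251. [folklore] -/
theorem hasDerivAt_mixedLetter (A B : (k : ℕ) → Fin d → (idx L M k → ℝ)) (k : ℕ) :
    HasDerivAt (fun r : ℝ => Pmodel L M (fun k' ν' (x' : idx L M k') => -(Complex.I * (A k' ν' x' : ℂ)) * Complex.exp ((Complex.I * (B k' ν' x' : ℂ) / ((lev L k' : ℕ) : ℂ)) * (r : ℂ))) k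
        + (Pmodel L M (fun k' ν' (x' : idx L M k') => -(Complex.I * (A k' ν' x' : ℂ)) * Complex.exp ((Complex.I * (B k' ν' x' : ℂ) / ((lev L k' : ℕ) : ℂ)) * (r : ℂ))) k)ᴴ
        + Matrix.diagonal (fun x' : idx L M k => -((lev L k : ℕ) : ℂ) ^ 2 * ∑ ν, ((Complex.I * (A k ν x' : ℂ) / ((lev L k : ℕ) : ℂ)) * Complex.exp ((Complex.I * (B k ν x' : ℂ) / ((lev L k : ℕ) : ℂ)) * (r : ℂ))
          + -(Complex.I * (A k ν x' : ℂ) / ((lev L k : ℕ) : ℂ)) * Complex.exp (-(Complex.I * (B k ν x' : ℂ) / ((lev L k : ℕ) : ℂ)) * (r : ℂ)))))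
      (Pmodel L M (fun k' ν' (x' : idx L M k') => -(Complex.I * (A k' ν' x' : ℂ)) * (Complex.I * (B k' ν' x' : ℂ) / ((lev L k' : ℕ) : ℂ))) k
        + (Pmodel L M (fun k' ν' (x' : idx L M k') => -(Complex.I * (A k' ν' x' : ℂ)) * (Complex.I * (B k' ν' x' : ℂ) / ((lev L k' : ℕ) : ℂ))) k)ᴴ
        + Matrix.diagonal (fun x' : idx L M k => -2 * ∑ ν, (Complex.I * (A k ν x' : ℂ)) * (Complex.I * (B k ν x' : ℂ)))) 0 :=
  ((hasDerivAt_Pmodel_curve L M k (fun μ y => hasDerivAt_mixedJetV L M A B k μ y)).add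
    (hasDerivAt_conjTranspose_Pmodel_curve L M k (fun μ y => hasDerivAt_mixedJetV L M A B k μ y))).add
    (hasDerivAt_diagonal_curve L M k
      (Z := fun (r : ℝ) (k' : ℕ) (x' : idx L M k') => -((lev L k' : ℕ) : ℂ) ^ 2 * ∑ ν, ((Complex.I * (A k' ν x' : ℂ) / ((lev L k' : ℕ) : ℂ)) * Complex.exp ((Complex.I * (B k' ν x' : ℂ) / ((lev L k' : ℕ) : ℂ)) * (r : ℂ))
          + -(Complex.I * (A k' ν x' : ℂ) / ((lev L k' : ℕ) : ℂ)) * Complex.exp (-(Complex.I * (B k' ν x' : ℂ) / ((lev L k' : ℕ) : ℂ)) * (r : ℂ))))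
      (Z' := fun (k' : ℕ) (x' : idx L M k') => -2 * ∑ ν, (Complex.I * (A k' ν x' : ℂ)) * (Complex.I * (B k' ν x' : ℂ)))
      (fun y => hasDerivAt_mixedJetZ L M A B k y))

/-- `mixedLetter_fst_zero`: at `r = 0` the first partial letter is the first letter of `A`, `P(−iA) + P(−iA)ᴴ + diag 0`: the hypothesis `ha` of PART 251. [folklore] -/
theorem mixedLetter_fst_zero (A B : (k : ℕ) → Fin d → (idx L M k → ℝ)) (k : ℕ) :
    Pmodel L M (fun k' ν' (x' : idx L M k') => -(Complex.I * (A k' ν' x' : ℂ)) * Complex.exp ((Complex.I * (B k' ν' x' : ℂ) / ((lev L k' : ℕ) : ℂ)) * ((0 : ℝ) : ℂ))) k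
        + (Pmodel L M (fun k' ν' (x' : idx L M k') => -(Complex.I * (A k' ν' x' : ℂ)) * Complex.exp ((Complex.I * (B k' ν' x' : ℂ) / ((lev L k' : ℕ) : ℂ)) * ((0 : ℝ) : ℂ))) k)ᴴ
        + Matrix.diagonal (fun x' : idx L M k => -((lev L k : ℕ) : ℂ) ^ 2 * ∑ ν, ((Complex.I * (A k ν x' : ℂ) / ((lev L k : ℕ) : ℂ)) * Complex.exp ((Complex.I * (B k ν x' : ℂ) / ((lev L k : ℕ) : ℂ)) * ((0 : ℝ) : ℂ))
          + -(Complex.I * (A k ν x' : ℂ) / ((lev L k : ℕ) : ℂ)) * Complex.exp (-(Complex.I * (B k ν x' : ℂ) / ((lev L k : ℕ) : ℂ)) * ((0 : ℝ) : ℂ))))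
      = Pmodel L M (fun k' ν' (x' : idx L M k') => -(Complex.I * (A k' ν' x' : ℂ))) k + (Pmodel L M (fun k' ν' (x' : idx L M k') => -(Complex.I * (A k' ν' x' : ℂ))) k)ᴴ
        + Matrix.diagonal (fun _ : idx L M k => (0 : ℂ)) := by
  rw [mixedCurveV_zero L M A B]
  congr 2
  funext x'
  simp only [Complex.ofReal_zero, mul_zero, Complex.exp_zero, mul_one, add_neg_cancel, Finset.sum_const_zero]

/-- **`hasDerivAt_covPert_expChart₂_snd_zero` — `∂_r|₀(Δ^{U_{0,r}} − Δ^1)^{(k)} = P(−iB) + P(−iB)ᴴ + diag 0`** (the swap `(A, B, s, r) ↔ (B, A, r, s)` in `hasDerivAt_covPert_expChart₂_fst` at `0`):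
the hypothesis `h01` of PART 251. [folklore] -/
theorem hasDerivAt_covPert_expChart₂_snd_zero (A B : (k : ℕ) → Fin d → (idx L M k → ℝ)) (k : ℕ) :
    HasDerivAt (fun r : ℝ => covPert L M (fun k' ν' (x' : idx L M k') => Complex.exp ((Complex.I * (A k' ν' x' : ℂ) / ((lev L k' : ℕ) : ℂ)) * ((0 : ℝ) : ℂ)
        + (Complex.I * (B k' ν' x' : ℂ) / ((lev L k' : ℕ) : ℂ)) * (r : ℂ))) k)
      (Pmodel L M (fun k' ν' (x' : idx L M k') => -(Complex.I * (B k' ν' x' : ℂ))) k + (Pmodel L M (fun k' ν' (x' : idx L M k') => -(Complex.I * (B k' ν' x' : ℂ))) k)ᴴ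
        + Matrix.diagonal (fun _ : idx L M k => (0 : ℂ))) 0 := by
  have e : (fun r : ℝ => covPert L M (fun k' ν' (x' : idx L M k') => Complex.exp ((Complex.I * (A k' ν' x' : ℂ) / ((lev L k' : ℕ) : ℂ)) * ((0 : ℝ) : ℂ)
        + (Complex.I * (B k' ν' x' : ℂ) / ((lev L k' : ℕ) : ℂ)) * (r : ℂ))) k)
      = fun r : ℝ => covPert L M (fun k' ν' (x' : idx L M k') => Complex.exp ((Complex.I * (B k' ν' x' : ℂ) / ((lev L k' : ℕ) : ℂ)) * (r : ℂ)
        + (Complex.I * (A k' ν' x' : ℂ) / ((lev L k' : ℕ) : ℂ)) * ((0 : ℝ) : ℂ))) k :=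
    funext fun r => by rw [expChart₂_swap L M A B 0 r]
  rw [e, ← mixedLetter_fst_zero L M B A k]
  exact hasDerivAt_covPert_expChart₂_fst L M B A 0 k

end Letters

end Summit.QuantumFields.BalabanUV.Beta.GAN24.ExponentialChartMixedJets

end
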